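import Mathlib.NumberTheory.NumberField.Basic
import Mathlib.RingTheory.DedekindDomain.Ideal.Lemmas
import Literature.NumberTheory.Automorphic.OrdinaryCompletedCohomologyGL
import Literature.NumberTheory.Automorphic.TameLevelScalarFactorisation
import Mathlib.NumberTheory.NumberField.Ideal.Basic
import HarnessLib

/-!
# Approximation of a global integer above `p` and at the bad places; norms and local units

Arithmetic inputs of the density step of the diamond-weight computation:

* `exists_mem_asIdeal_natCast`: a number field has a place above `p`;
* `dvd_norm_sub_norm_of_sub_mem`: `y ≡ u (mod p^B 𝓞 F) ⟹ N(y) ≡ N(u) (mod p^B)` (the norm is the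
  determinant of left multiplication in a `ℤ`-basis);
* `sub_mem_span_pow_of_forall`: `y - u ∈ v^{B·ord_v p}` for all `v ∣ p` ⟹ `y - u ∈ (p^B)`;
* `exists_unit_eq_of_valued_sub_le`: a local unit congruent to a given one.
[folklore]
-/

open Literature.NumberTheory.Automorphic Literature.NumberTheory.Automorphic.BigHeckeGLn
open NumberField IsDedekindDomain

namespace Literature.NumberTheory.Automorphic.BigHeckeGLn

noncomputable section

variable {F : Type} [Field F] [NumberField F]

/-- **A number field has a place above every rational prime** (`p` is not a unit of `𝓞 F`: its norm
is `p^{[F:ℚ]} ≠ ±1`). [folklore] -/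
theorem exists_mem_asIdeal_natCast (p : ℕ) [hp : Fact p.Prime] :
    ∃ v : HeightOneSpectrum (𝓞 F), (p : 𝓞 F) ∈ v.asIdeal := by
  have hnu : ¬ IsUnit ((p : 𝓞 F)) := fun h => by
    have h1 := h.map (Algebra.norm ℤ)
    rw [← map_natCast (algebraMap ℤ (𝓞 F)) p, Algebra.norm_algebraMap, Int.isUnit_iff_natAbs_eq, Int.natAbs_pow,
      Int.natAbs_natCast] at h1
    exact (Nat.one_lt_pow (Module.finrank_pos (R := ℤ) (M := 𝓞 F)).ne' hp.out.one_lt).ne' h1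
  obtain ⟨M, hM, hle⟩ := Ideal.exists_le_maximal (Ideal.span {(p : 𝓞 F)})
    (by rwa [Ne, Ideal.span_singleton_eq_top])
  refine ⟨⟨M, hM.isPrime, fun hbot => ?_⟩, hle (Ideal.mem_span_singleton_self _)⟩
  have h := hle (Ideal.mem_span_singleton_self _)
  rw [hbot, Ideal.mem_bot] at h
  exact (Nat.cast_ne_zero.2 hp.out.ne_zero) h

/-- **`y ≡ u (mod p^B) ⟹ N(y) ≡ N(u) (mod p^B)`**: the norm is a polynomial with integer
coefficients in the coordinates (determinant of left multiplication). [folklore] -/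
theorem dvd_norm_sub_norm_of_sub_mem {y u : 𝓞 F} {M : ℕ} (h : y - u ∈ Ideal.span {((M : ℕ) : 𝓞 F)}) :
    (M : ℤ) ∣ Algebra.norm ℤ y - Algebra.norm ℤ u := by
  classical
  obtain ⟨z, hz⟩ := Ideal.mem_span_singleton'.1 h
  set b := RingOfIntegers.basis F
  have hy : y = u + (algebraMap ℤ (𝓞 F) (M : ℤ)) * z := by
    rw [map_natCast, mul_comm, hz]; abel
  have hmat : Algebra.leftMulMatrix b y = Algebra.leftMulMatrix b u + (M : ℤ) • Algebra.leftMulMatrix b z := by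
    rw [hy, map_add, map_mul, AlgHom.commutes, Algebra.algebraMap_eq_smul_one, smul_mul_assoc, one_mul]
  set f := Int.castRingHom (ZMod M) with hf
  have hred : f.mapMatrix (Algebra.leftMulMatrix b y) = f.mapMatrix (Algebra.leftMulMatrix b u) := by
    rw [hmat, map_add, map_zsmul, ← Int.cast_smul_eq_zsmul (ZMod M), Int.cast_natCast, ZMod.natCast_self, zero_smul,
      add_zero]
  have hdet := congrArg Matrix.det hred
  rw [← RingHom.map_det, ← RingHom.map_det, ← Algebra.norm_eq_matrix_det, ← Algebra.norm_eq_matrix_det, hf,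
    Int.coe_castRingHom, ZMod.intCast_eq_intCast_iff_dvd_sub] at hdet
  -- hdet : (M:ℤ) ∣ norm u - norm y
  have := dvd_neg.2 hdet
  rwa [neg_sub] at this

/-- **Membership in `(p^B)` from memberships at the places above `p`**: if `r ∈ v^{B · ord_v p}` for
every `v ∣ p` then `r ∈ (p)^B = (p^B)` (factorisation of `(p)` and coprimality). [folklore] -/
theorem mem_span_natCast_pow_of_forall (p : ℕ) [hp : Fact p.Prime] {r : 𝓞 F} (B : ℕ)
    (h : ∀ v : HeightOneSpectrum (𝓞 F), (p : 𝓞 F) ∈ v.asIdeal → r ∈ v.asIdeal ^ (ordAt v (p : 𝓞 F) * B)) :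
    r ∈ Ideal.span {((p ^ B : ℕ) : 𝓞 F)} := by
  classical
  have hp0 : (p : 𝓞 F) ≠ 0 := Nat.cast_ne_zero.2 hp.out.ne_zero
  have hI0 : Ideal.span {(p : 𝓞 F)} ≠ 0 := by
    rw [Ne, Ideal.zero_eq_bot, Ideal.span_singleton_eq_bot]; exact hp0
  -- `(p) = ∏_{v ∣ p} v^{ord_v p}`
  have hfact : Ideal.span {(p : 𝓞 F)} = ∏ v ∈ placesAbove F p, v.asIdeal ^ ordAt v (p : 𝓞 F) := by
    conv_lhs => rw [← Ideal.finprod_heightOneSpectrum_factorization hI0]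
    refine finprod_eq_prod_of_mulSupport_subset _ fun v hv => ?_
    rw [Function.mem_mulSupport] at hv
    rw [Finset.mem_coe, mem_placesAbove, ← Ideal.dvd_span_singleton, ← ordAt_ne_zero_iff v hp0]
    intro h0
    apply hv
    change v.asIdeal ^ ordAt v (p : 𝓞 F) = 1
    rw [h0, pow_zero]
  rw [Nat.cast_pow, ← Ideal.span_singleton_pow, hfact, ← Finset.prod_pow]
  simp_rw [← pow_mul]
  rw [← IsDedekindDomain.inf_pow_eq_prod_of_prime (placesAbove F p) (fun v => v.asIdeal) _ (fun v _ => v.prime)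
    (fun v _ w _ hvw => fun h => hvw (HeightOneSpectrum.ext h))]
  refine Submodule.mem_finsetInf.2 fun v hv => ?_
  exact h v (mem_placesAbove.1 hv)

/-- Valuation bound from membership in a power of the prime: `r ∈ v^e ⟹ |r|_v ≤ |ϖ_v|^e`. [folklore] -/
theorem valued_algebraMap_le_of_mem_pow {v : HeightOneSpectrum (𝓞 F)} {r : 𝓞 F} {e : ℕ} (h : r ∈ v.asIdeal ^ e) :
    Valued.v (algebraMap F (v.adicCompletion F) (r : F)) ≤ WithZero.exp (-(e : ℤ)) := by
  refine (HeightOneSpectrum.valuedAdicCompletion_eq_valuation' v (r : F)).trans_le ?_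
  rw [HeightOneSpectrum.valuation_of_algebraMap, HeightOneSpectrum.intValuation_le_pow_iff_dvd]
  exact Ideal.dvd_span_singleton.2 h

/-- **A local unit congruent to a given one.** If `t ∈ K_v` satisfies `|t - a| ≤ |ϖ_v|^e` (`e ≥ 1`)
for a unit `a ∈ 𝒪_vˣ`, then `t` is (the image of) a unit `b ∈ 𝒪_vˣ` with `|a⁻¹ b - 1| ≤ |ϖ_v|^e`.
[folklore] -/
theorem exists_unit_eq_of_valued_sub_le {v : HeightOneSpectrum (𝓞 F)} (a : (v.adicCompletionIntegers F)ˣ)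
    (t : v.adicCompletion F) {e : ℕ} (he : 1 ≤ e)
    (h : Valued.v (t - ((a : v.adicCompletionIntegers F) : v.adicCompletion F)) ≤ WithZero.exp (-(e : ℤ))) :
    ∃ b : (v.adicCompletionIntegers F)ˣ, ((b : v.adicCompletionIntegers F) : v.adicCompletion F) = t ∧
      Valued.v ((((a⁻¹ * b : (v.adicCompletionIntegers F)ˣ) : v.adicCompletionIntegers F) : v.adicCompletion F) - 1) ≤
        WithZero.exp (-(e : ℤ)) := by
  set α : v.adicCompletion F := ((a : v.adicCompletionIntegers F) : v.adicCompletion F) with hα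
  have hαv : Valued.v α = 1 := valued_coe_units_adicCompletionIntegers v a
  have hlt : Valued.v (t - α) < Valued.v α := by
    rw [hαv]
    refine h.trans_lt ?_
    rw [← WithZero.exp_zero, WithZero.exp_lt_exp]; omega
  have htv : Valued.v t = 1 := by
    have := Valued.v.map_add_eq_of_lt_left hlt
    rwa [add_sub_cancel, hαv] at this
  have ht0 : t ≠ 0 := fun h0 => by rw [h0, map_zero] at htv; exact zero_ne_one htv
  have htmem : t ∈ v.adicCompletionIntegers F := (HeightOneSpectrum.mem_adicCompletionIntegers (R := 𝓞 F) F v).2 htv.le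
  have htinv : t⁻¹ ∈ v.adicCompletionIntegers F :=
    (HeightOneSpectrum.mem_adicCompletionIntegers (R := 𝓞 F) F v).2 (by rw [map_inv₀, htv, inv_one])
  refine ⟨⟨⟨t, htmem⟩, ⟨t⁻¹, htinv⟩, Subtype.ext (mul_inv_cancel₀ ht0), Subtype.ext (inv_mul_cancel₀ ht0)⟩, rfl, ?_⟩
  have hα0 : α ≠ 0 := fun h0 => by rw [h0, map_zero] at hαv; exact zero_ne_one hαv
  have hval : ((((a⁻¹ * ⟨⟨t, htmem⟩, ⟨t⁻¹, htinv⟩, Subtype.ext (mul_inv_cancel₀ ht0), Subtype.ext (inv_mul_cancel₀ ht0)⟩ :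
      (v.adicCompletionIntegers F)ˣ) : v.adicCompletionIntegers F) : v.adicCompletion F)) = α⁻¹ * t := by
    rw [Units.val_mul, Subring.coe_mul]
    congr 1
    refine eq_inv_of_mul_eq_one_left ?_
    rw [← Subring.coe_mul, ← Units.val_mul, inv_mul_cancel, Units.val_one, OneMemClass.coe_one]
  rw [hval, show α⁻¹ * t - 1 = α⁻¹ * (t - α) by field_simp, map_mul, map_inv₀, hαv, inv_one, one_mul]
  exact h

end

end Literature.NumberTheory.Automorphic.BigHeckeGLn

/-!
## The norm of a global element as the product of the residue cardinalities of its primes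

`|N_{K/ℚ}(u)| = ∏_{w ∣ u} q_w^{ord_w u}` (`Ideal.absNorm_span_singleton` and the factorisation of
`(u)`, Mathlib `Ideal.finprod_heightOneSpectrum_factorization`), in the form indexed by the
`goodSupport` of the diamond-weight computation (when `u` is a unit at the bad places). [folklore]
-/

open Literature.NumberTheory.Automorphic Literature.NumberTheory.Automorphic.BigHeckeGLn
open NumberField IsDedekindDomain

namespace Literature.NumberTheory.Automorphic.BigHeckeGLn

variable {K : Type} [Field K] [NumberField K]

/-- `|N(u)| = ∏ᶠ_w q_w^{ord_w u}` for `u ∈ 𝓞 K ∖ 0`. [folklore] -/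
theorem finprod_absNorm_pow_ordAt {u : 𝓞 K} (hu : u ≠ 0) :
    ∏ᶠ w : HeightOneSpectrum (𝓞 K), Ideal.absNorm w.asIdeal ^ ordAt w u = (Algebra.norm ℤ u).natAbs := by
  have h0 : Ideal.span {u} ≠ 0 := by
    rw [Ne, Ideal.zero_eq_bot, Ideal.span_singleton_eq_bot]; exact hu
  rw [← Ideal.absNorm_span_singleton, ← Ideal.finprod_heightOneSpectrum_factorization h0]
  have h := MonoidHom.map_finprod (Ideal.absNorm : Ideal (𝓞 K) →*₀ ℕ).toMonoidHom (Ideal.hasFiniteMulSupport h0)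
  refine Eq.trans ?_ h.symm
  refine finprod_congr fun w => ?_
  change _ = Ideal.absNorm (w.maxPowDividing (Ideal.span {u}))
  rw [HeightOneSpectrum.maxPowDividing, map_pow]
  rfl

variable {n : ℕ} {p : ℕ} [Fact p.Prime] (𝒰 : TameLevel n K p)

/-- **`∏_{w ∈ goodSupport} q_w^{ord_w u} = |N(u)|`** for `u ∈ 𝓞 K ∖ 0` a unit at every bad place.
[folklore] -/
theorem prod_goodSupport_absNorm_pow_ordAt {u : 𝓞 K} (hu : u ≠ 0) (hbad : ∀ w ∈ 𝒰.bad, ordAt w u = 0) :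
    ∏ w ∈ goodSupport 𝒰 u hu, Ideal.absNorm w.asIdeal ^ ordAt w u = (Algebra.norm ℤ u).natAbs := by
  rw [← finprod_absNorm_pow_ordAt hu]
  refine (finprod_eq_prod_of_mulSupport_subset _ fun w hw => ?_).symm
  rw [Function.mem_mulSupport] at hw
  rw [Finset.mem_coe, mem_goodSupport]
  have h : ordAt w u ≠ 0 := fun h => hw (by rw [h, pow_zero])
  exact ⟨h, fun hb => h (hbad w hb)⟩

/-- The same identity cast into a commutative ring: `∏_{w ∈ goodSupport} q_w^{ord_w u} = |N(u)|`.
[folklore] -/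
theorem prod_goodSupport_natCast_absNorm_pow_ordAt {A : Type*} [CommRing A] {u : 𝓞 K} (hu : u ≠ 0)
    (hbad : ∀ w ∈ 𝒰.bad, ordAt w u = 0) :
    ∏ w ∈ goodSupport 𝒰 u hu, ((Ideal.absNorm w.asIdeal : ℕ) : A) ^ ordAt w u = ((|Algebra.norm ℤ u| : ℤ) : A) := by
  have h := congrArg (fun m : ℕ => (m : A)) (prod_goodSupport_absNorm_pow_ordAt 𝒰 hu hbad)
  simp only [Nat.cast_prod, Nat.cast_pow] at h
  rw [h, ← Int.natCast_natAbs, Int.cast_natCast]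

end Literature.NumberTheory.Automorphic.BigHeckeGLn
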